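import Mathlib.RingTheory.PowerSeries.Basic
import Mathlib.RingTheory.PowerSeries.Inverse
import Mathlib.RingTheory.PowerSeries.Ideal
import Mathlib.RingTheory.PowerSeries.WeierstrassPreparation
import Mathlib.RingTheory.Polynomial.Eisenstein.Distinguished
import Mathlib.RingTheory.Length
import Mathlib.RingTheory.Ideal.Height
import Mathlib.RingTheory.Ideal.UFD
import Mathlib.RingTheory.Ideal.IsPrincipal
import Mathlib.Algebra.Module.LocalizedModule.Basic
import Mathlib.RingTheory.Localization.AtPrime.Basic
import Mathlib.NumberTheory.Padics.PadicIntegers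
import Mathlib.LinearAlgebra.TensorProduct.Basic
import Mathlib.LinearAlgebra.Dimension.Finrank
import Mathlib.Algebra.Algebra.RestrictScalars
import Mathlib.Algebra.DirectSum.Module
import Mathlib.RingTheory.Ideal.Quotient.Basic
import Mathlib.Algebra.Module.Torsion.Basic
import Mathlib.RingTheory.KrullDimension.Regular
import Mathlib.RingTheory.KrullDimension.PID
import Mathlib.RingTheory.Flat.Localization
import Mathlib.RingTheory.IsAdjoinRoot
import Mathlib.Algebra.BigOperators.Fin
import Mathlib.LinearAlgebra.DirectSum.Basis
import Mathlib.LinearAlgebra.DirectSum.Finite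
import HarnessLib

-- provenance: harness21/H21/H21/Prelude/EllArithM/IwasawaAlgebra.lean @ eecc4ae (interim HEAD d8f2665); M5 mechanical rewrite
/-!
# The Iwasawa algebra `Λ = ℤₚ⟦T⟧` and the invariants of `Λ`-modules

Trunk `EllArithM`, item C11 (`iwasawa_algebra_invariants`). Mathlib-only prelude file.

We set up, in Mathlib generality first and then for the Iwasawa algebra
`Λ = ℤ_[p]⟦T⟧ = PowerSeries ℤ_[p]`:

* `Literature.Module.lengthAt R M 𝔭` : the length of the localisation `M_𝔭` over `R_𝔭`;
* `Literature.Module.heightOneSupport R M` : the height-one primes in the support of `M`;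
* `Literature.Module.charIdeal R M = ∏_{ht 𝔭 = 1} 𝔭 ^ length (M_𝔭)` : the characteristic ideal;
* `Literature.NumberTheory.EllipticCurves.Module.IsPseudoNull`, `Literature.NumberTheory.EllipticCurves.LinearMap.IsPseudoIsomorphism`, `Literature.NumberTheory.EllipticCurves.Module.ArePseudoIsomorphic` :
  pseudo-null modules and pseudo-isomorphisms (Bourbaki, *Algèbre commutative* VII §4.4);
* `Literature.IwasawaAlgebra p := PowerSeries ℤ_[p]`, the prime `(p) = augIdealP p`, the `μ`- and
  `λ`-invariants `Literature.NumberTheory.EllipticCurves.muInvariant`, `Literature.NumberTheory.EllipticCurves.lambdaInvariant`, elementary modules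
  `Literature.NumberTheory.EllipticCurves.elementaryModule`, and the structure theorem for finitely generated torsion `Λ`-modules
  (Iwasawa, Serre; Washington, *Introduction to Cyclotomic Fields*, Thm 13.12) together with the
  standard consequences (`charIdeal_eq_span`, `charIdeal_isPrincipal`, `muInvariant_eq_sum`,
  `lambdaInvariant_eq_sum_natDegree`, `muInvariant_eq_zero_iff`, `charIdeal_mul_of_shortExact`).

## Mathlib reuse

* `PowerSeries`, `PowerSeries.C`, `IsNoetherianRing (PowerSeries _)` (by `inferInstance`),
  `PowerSeries.isUnit_iff_constantCoeff` (a power series is a unit iff its constant coefficient is;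
  Washington Lemma 13.5 needs no H21 restatement).
* Distinguished polynomials are Mathlib's `Polynomial.IsDistinguishedAt f (IsLocalRing.maximalIdeal ℤ_[p])`
  (`Mathlib/RingTheory/Polynomial/Eisenstein/Distinguished.lean`); no H21 declaration.
* The Weierstrass preparation theorem for `ℤ_[p]⟦T⟧` is Mathlib's
  `PowerSeries.exists_isWeierstrassFactorization` / `PowerSeries.IsWeierstrassFactorizationAt`
  and the division theorem `PowerSeries.exists_isWeierstrassDivision`
  (`Mathlib/RingTheory/PowerSeries/WeierstrassPreparation.lean`); we only point to them.
* `Module.length`, `Localization.AtPrime`, `LocalizedModule`, `PrimeSpectrum`, `Ideal.height`,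
  `finprod`/`finsum`, `Module.finrank`, `TensorProduct`, `RestrictScalars`, `DirectSum`.

Mathlib (at the pinned commit) has no characteristic ideal, pseudo-null module or
pseudo-isomorphism; the generic declarations below live in `Literature.Module` / `Literature.LinearMap`
and their intended Mathlib home is `Mathlib/RingTheory/Support/CharacteristicIdeal.lean` (say).

## Design choices and junk values

* `lengthAt` is `ℕ∞`-valued (Mathlib's `Module.length`). In `charIdeal` and `muInvariant` we use
  `ENat.toNat`, so an infinite local length contributes exponent `0`; and `finprod`/`finsum` return
  `1`/`0` on infinite support. Both junk cases are vacuous for finitely generated torsion modules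
  over a Noetherian normal domain (in particular over `Λ`), which is the only case the statements use.
* `elementaryModule` is indexed by *lists* `μs : List ℕ`, `fs : List (Polynomial ℤ_[p] × ℕ)`
  (rather than multisets): a list gives an honest index type `Fin μs.length` without `DecidableEq`
  on `Polynomial ℤ_[p]`; the module only depends on the lists up to permutation (up to isomorphism).
* `lambdaInvariant p M := finrank ℚ_[p] (ℚ_[p] ⊗[ℤ_[p]] M)`; `finrank` is `0` on
  infinite-dimensional spaces, again vacuous for f.g. torsion `Λ`-modules (Washington Prop. 13.8:
  then `M ⊗ ℚₚ` is finite-dimensional of dimension `λ = ∑ nⱼ deg fⱼ`).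
* `ArePseudoIsomorphic R M N` is the existence of a pseudo-isomorphism `M → N`; this relation is not
  symmetric in general (it is for f.g. torsion `Λ`-modules, Washington §13.2 Remark), documented.
* `IsPseudoNull` and `ArePseudoIsomorphic` take their binders `(R) (M)` / `(R) (M N)` explicitly in
  the signature rather than from a `variable` line: they are *predicates* (definitions), not closed
  named facts — their universal closures are false (`Literature.NumberTheory.EllipticCurves.Module.not_isPseudoNull_self`,
  `Literature.NumberTheory.EllipticCurves.Module.not_arePseudoIsomorphic_punit` in `IwasawaAlgebraPseudoNullProofs`). The resulting
  constants are unchanged (same binder names, order and kinds).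

## References

* L. Washington, *Introduction to Cyclotomic Fields*, GTM 83, §13.1–13.2 (Lemma 13.5, Prop. 13.8,
  Thm 13.12, Lemma 13.21).
* N. Bourbaki, *Algèbre commutative*, Ch. VII §4.4 (pseudo-isomorphisms, characteristic ideals).
* J. Neukirch, A. Schmidt, K. Wingberg, *Cohomology of Number Fields*, Ch. V §3.
* S. Lang, *Cyclotomic Fields (I and) II* (`Lang1980`), Ch. 5 §2 Thm. 2.1 (Euclidean algorithm),
  Thm. 2.2 (Weierstrass preparation), §3 Thm. 3.1 (structure theorem) — used for the discharge below.

## Discharges (appended)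

* `Literature.NumberTheory.EllipticCurves.lambdaInvariant_eq_sum_natDegree_holds` proves `lambdaInvariant_eq_sum_natDegree` from
  Mathlib: `dim Λ = 2` (`Literature.NumberTheory.EllipticCurves.IwasawaAlgebra.ringKrullDim_eq_two`), hence pseudo-null `Λ`-modules
  are `p`-power torsion elementwise (`Literature.NumberTheory.EllipticCurves.exists_C_p_pow_smul_eq_zero_of_isPseudoNull`); flat base
  change to `ℚₚ` (`Literature.NumberTheory.EllipticCurves.Module.bijective_baseChange_of_pow_smul`); and
  `rank_{ℤₚ} Λ/(fⁿ) = n · deg f` for distinguished `f` (`Literature.NumberTheory.EllipticCurves.finrank_quotient_pow`, Weierstrass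
  division via `Polynomial.IsDistinguishedAt.algEquivQuotient`).
* `Literature.NumberTheory.EllipticCurves.charIdeal_isPrincipal_holds` proves `charIdeal_isPrincipal` from Mathlib: `Λ = ℤ_[p]⟦T⟧`
  is a UFD (Mathlib's instance for power series over a PID, found through the abbreviation), so
  every height-one prime is principal (`UniqueFactorizationMonoid.isPrincipal_of_height_eq_one`)
  and `charIdeal Λ M`, a `finprod` of powers of such primes, lies in `Ideal.isPrincipalSubmonoid`.
-/

noncomputable section

open scoped Polynomial TensorProduct DirectSum

namespace Literature.NumberTheory.EllipticCurves

/-! ### Generic commutative algebra: local lengths, characteristic ideal, pseudo-null modules -/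

namespace Module

variable (R : Type*) [CommRing R] (M : Type*) [AddCommGroup M] [_root_.Module R M]

/-- The *local length* of `M` at a prime `𝔭`: the length of the localised module `M_𝔭` over the
local ring `R_𝔭`, as an extended natural number. (Bourbaki AC VII §4.4; Washington §13.2.)
Intended Mathlib home: next to `Module.length`. [folklore] -/
def lengthAt (𝔭 : PrimeSpectrum R) : ℕ∞ :=
  Module.length (Localization.AtPrime 𝔭.asIdeal) (LocalizedModule 𝔭.asIdeal.primeCompl M)

/-- The *height-one support* of `M`: the primes `𝔭` of height one at which `M_𝔭 ≠ 0`
(equivalently `lengthAt R M 𝔭 ≠ 0`). For a f.g. torsion module over a Noetherian normal domain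
this set is finite (Bourbaki AC VII §4.4 Thm 3). [folklore] -/
def heightOneSupport : Set (PrimeSpectrum R) :=
  {𝔭 | 𝔭.asIdeal.height = 1 ∧ lengthAt R M 𝔭 ≠ 0}

/-- The *characteristic ideal* of `M`:
`char(M) = ∏_{ht 𝔭 = 1} 𝔭 ^ length_{R_𝔭}(M_𝔭)` (Bourbaki AC VII §4.4–4.5; Washington §13.2,
NSW V.3). Junk values: an infinite local length contributes exponent `0` (`ENat.toNat ⊤ = 0`) and
`finprod` is `1` when infinitely many factors are `≠ 1`; both are vacuous for f.g. torsion modules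
over a Noetherian integrally closed domain, e.g. over the Iwasawa algebra.
Intended Mathlib home: `Mathlib/RingTheory/Support/`. [folklore] -/
def charIdeal : Ideal R :=
  ∏ᶠ 𝔭 ∈ {𝔭 : PrimeSpectrum R | 𝔭.asIdeal.height = 1}, 𝔭.asIdeal ^ (lengthAt R M 𝔭).toNat

end Module

namespace Module

/-- `M` is *pseudo-null* if `M_𝔭 = 0` for every prime `𝔭` of height `≤ 1`
(Bourbaki AC VII §4.4 Def. 2; NSW Ch. V §1). Over `Λ = ℤₚ⟦T⟧`, a finitely generated module is
pseudo-null iff it is finite (Washington §13.2). This is a *predicate* on the pair `(R, M)`, written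
with explicit binders (it is not a closed statement: a nontrivial ring is not pseudo-null over
itself, `Literature.NumberTheory.EllipticCurves.Module.not_isPseudoNull_self`). [folklore] -/
def IsPseudoNull (R : Type*) [CommRing R]
    (M : Type*) [AddCommGroup M] [_root_.Module R M] : Prop :=
  ∀ 𝔭 : PrimeSpectrum R, 𝔭.asIdeal.height ≤ 1 →
    Subsingleton (LocalizedModule 𝔭.asIdeal.primeCompl M)

end Module

namespace LinearMap

variable {R : Type*} [CommRing R] {M N : Type*} [AddCommGroup M] [_root_.Module R M]
  [AddCommGroup N] [_root_.Module R N]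

/-- A linear map `f : M → N` is a *pseudo-isomorphism* if its kernel and cokernel are pseudo-null
(Bourbaki AC VII §4.4 Def. 3; Washington §13.2: "finite kernel and cokernel" over `Λ`). [folklore] -/
def IsPseudoIsomorphism (f : M →ₗ[R] N) : Prop :=
  Module.IsPseudoNull R (LinearMap.ker f) ∧ Module.IsPseudoNull R (N ⧸ LinearMap.range f)

end LinearMap

namespace Module

/-- `M` and `N` are *pseudo-isomorphic*, written `M ∼ N` in Washington §13.2, if there is a
pseudo-isomorphism `M →ₗ[R] N`. Warning: this relation is not symmetric in general
(Washington §13.2, example `(p, T) → Λ`); it is an equivalence relation on finitely generated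
torsion `Λ`-modules. A *predicate* on `(R, M, N)`, written with explicit binders (not a closed
statement: `Literature.NumberTheory.EllipticCurves.Module.not_arePseudoIsomorphic_punit`). [folklore] -/
def ArePseudoIsomorphic (R : Type*) [CommRing R] (M N : Type*) [AddCommGroup M]
    [_root_.Module R M] [AddCommGroup N] [_root_.Module R N] : Prop :=
  ∃ f : M →ₗ[R] N, LinearMap.IsPseudoIsomorphism f

end Module

/-! ### The Iwasawa algebra -/

/-- The *Iwasawa algebra* `Λ = ℤ_[p]⟦T⟧`, the ring of formal power series in one variable over the
`p`-adic integers (Washington §13.1; NSW Ch. V §3 identifies it with `ℤₚ⟦Γ⟧`, `γ ↦ 1 + T`).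
It is a Noetherian (`inferInstance`) complete regular local ring of dimension `2`. [folklore] -/
abbrev IwasawaAlgebra (p : ℕ) [Fact p.Prime] : Type := PowerSeries ℤ_[p]

namespace IwasawaAlgebra

variable (p : ℕ) [Fact p.Prime]

example : IsNoetherianRing (IwasawaAlgebra p) := inferInstance

/-- The height-one prime `(p) ⊂ Λ = ℤ_[p]⟦T⟧`, generated by the constant power series `p`;
the `μ`-invariant of a `Λ`-module is its local length at this prime (Washington §13.2). [folklore] -/
def augIdealP : Ideal (IwasawaAlgebra p) :=
  Ideal.span {PowerSeries.C (p : ℤ_[p])}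

/-- `(p) ⊂ ℤ_[p]⟦T⟧` is a prime ideal: `Λ/(p) ≅ 𝔽ₚ⟦T⟧` is a domain (Washington §13.1). [cite: Washington1997, §13.1] -/
def isPrime_augIdealP : Prop :=
  (augIdealP p).IsPrime

/-- `(p) ⊂ ℤ_[p]⟦T⟧` has height one (a nonzero principal prime in the two-dimensional regular
local ring `Λ`; Washington §13.2). [cite: Washington1997, §13.2] -/
def height_augIdealP : Prop :=
  (augIdealP p).height = 1

end IwasawaAlgebra

/-! ### Invariants of `Λ`-modules -/

section Invariants

open IwasawaAlgebra

variable (p : ℕ) [Fact p.Prime]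

/-- The *`μ`-invariant* of a `Λ`-module `M`: the local length of `M` at the height-one prime
`(p)`, i.e. the exponent of `(p)` in `charIdeal Λ M`; for `M ∼ ⨁ Λ/(p^{μᵢ}) ⊕ ⨁ Λ/(fⱼ^{nⱼ})` it
equals `∑ μᵢ` (Washington §13.2, after Thm 13.12). Written as a `finsum` over the (one-element)
set of primes equal to `(p)` so that no primality proof enters the data; junk value `0` if the
local length is infinite (vacuous for f.g. torsion modules). [folklore] -/
def muInvariant (M : Type*) [AddCommGroup M] [Module (IwasawaAlgebra p) M] : ℕ :=
  ∑ᶠ 𝔭 ∈ {𝔭 : PrimeSpectrum (IwasawaAlgebra p) | 𝔭.asIdeal = augIdealP p},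
    (Module.lengthAt (IwasawaAlgebra p) M 𝔭).toNat

/-- The *`λ`-invariant* of a `Λ`-module `M`: `dim_{ℚₚ} (M ⊗_{ℤₚ} ℚₚ)`; for
`M ∼ ⨁ Λ/(p^{μᵢ}) ⊕ ⨁ Λ/(fⱼ^{nⱼ})` with `fⱼ` distinguished it equals `∑ nⱼ deg fⱼ`
(Washington §13.2, Prop. 13.8 and after Thm 13.12). Junk value `0` (`Module.finrank`) when
`M ⊗ ℚₚ` is infinite-dimensional, vacuous for f.g. torsion `Λ`-modules. [folklore] -/
def lambdaInvariant (M : Type*) [AddCommGroup M] [Module (IwasawaAlgebra p) M] : ℕ :=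
  Module.finrank ℚ_[p] (ℚ_[p] ⊗[ℤ_[p]] (RestrictScalars ℤ_[p] (IwasawaAlgebra p) M))

/-- The *elementary* torsion `Λ`-module attached to exponents `μs = [μ₁, …, μᵣ]` and pairs
`fs = [(f₁, n₁), …, (fₛ, nₛ)]` of polynomials with exponents:
`E(μs, fs) = ⨁ᵢ Λ/(p^{μᵢ}) ⊕ ⨁ⱼ Λ/(fⱼ^{nⱼ})` (Washington Thm 13.12). Lists are used as honest
index types; the isomorphism class only depends on the underlying multisets. [folklore] -/
def elementaryModule (μs : List ℕ) (fs : List (ℤ_[p][X] × ℕ)) : Type :=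
  (⨁ i : Fin μs.length,
      IwasawaAlgebra p ⧸ Ideal.span {PowerSeries.C ((p : ℤ_[p]) ^ μs.get i)}) ×
    ⨁ j : Fin fs.length,
      IwasawaAlgebra p ⧸ Ideal.span {((fs.get j).1 : IwasawaAlgebra p) ^ (fs.get j).2}

/-- `instance` — interim instance carried over undocumented from `harness21/H21/H21/Prelude/EllArithM/IwasawaAlgebra.lean:210` (docstring generated by the M5 import). [folklore] -/
instance (μs : List ℕ) (fs : List (ℤ_[p][X] × ℕ)) : AddCommGroup (elementaryModule p μs fs) :=
  inferInstanceAs (AddCommGroup (_ × _))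

/-- `instance` — interim instance carried over undocumented from `harness21/H21/H21/Prelude/EllArithM/IwasawaAlgebra.lean:213` (docstring generated by the M5 import). [folklore] -/
instance (μs : List ℕ) (fs : List (ℤ_[p][X] × ℕ)) :
    Module (IwasawaAlgebra p) (elementaryModule p μs fs) :=
  inferInstanceAs (Module (IwasawaAlgebra p) (_ × _))

/-- The *characteristic power series* attached to elementary data:
`p^{∑ μᵢ} · ∏ⱼ fⱼ^{nⱼ} ∈ Λ` (Washington §13.2). [folklore] -/
def charElement (μs : List ℕ) (fs : List (ℤ_[p][X] × ℕ)) : IwasawaAlgebra p :=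
  PowerSeries.C ((p : ℤ_[p]) ^ μs.sum) * (fs.map fun f => (f.1 : IwasawaAlgebra p) ^ f.2).prod

variable (M : Type*) [AddCommGroup M] [Module (IwasawaAlgebra p) M]

/-- A finitely generated `Λ`-module is pseudo-null iff it is finite (Washington §13.2;
NSW Ch. V §3: for `Λ`-modules pseudo-null = finite). [cite: NeukirchSchmidtWingberg2008, Ch. V §3 (pseudo-null = finite for Λ-modules); Washington §13.2] -/
def isPseudoNull_iff_finite : Prop :=
  ∀ [Module.Finite (IwasawaAlgebra p) M],
    Module.IsPseudoNull (IwasawaAlgebra p) M ↔ Finite M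

/-- **Structure theorem for finitely generated torsion `Λ`-modules** (Iwasawa, Serre;
Washington Thm 13.12, NSW Ch. V §3, Bourbaki AC VII §4.4 Thm 5): a finitely generated torsion
`Λ`-module is pseudo-isomorphic to an elementary module `⨁ Λ/(p^{μᵢ}) ⊕ ⨁ Λ/(fⱼ^{nⱼ})` with
`μᵢ, nⱼ ≥ 1` and `fⱼ ∈ ℤₚ[T]` distinguished and irreducible. [cite: Washington1997, Thm. 13.12] -/
def exists_isPseudoIsomorphism_elementary : Prop :=
  ∀ [Module.Finite (IwasawaAlgebra p) M] (hM : Module.IsTorsion (IwasawaAlgebra p) M),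
    ∃ (μs : List ℕ) (fs : List (ℤ_[p][X] × ℕ)),
      (∀ μ ∈ μs, 0 < μ) ∧
      (∀ f ∈ fs, f.1.IsDistinguishedAt (IsLocalRing.maximalIdeal ℤ_[p]) ∧
        Irreducible f.1 ∧ 0 < f.2) ∧
      Module.ArePseudoIsomorphic (IwasawaAlgebra p) M (elementaryModule p μs fs)

/-- The characteristic ideal of a `Λ`-module pseudo-isomorphic to the elementary module
`E(μs, fs)` (with distinguished `fⱼ`) is generated by the characteristic power series
`p^{∑ μᵢ} ∏ fⱼ^{nⱼ}` (Washington §13.2; NSW Ch. V §3). [cite: Washington1997, §13.2] -/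
def charIdeal_eq_span : Prop :=
  ∀ [Module.Finite (IwasawaAlgebra p) M] {μs : List ℕ} {fs : List (ℤ_[p][X] × ℕ)} (hfs : ∀ f ∈ fs, f.1.IsDistinguishedAt (IsLocalRing.maximalIdeal ℤ_[p])) (h : Module.ArePseudoIsomorphic (IwasawaAlgebra p) M (elementaryModule p μs fs)),
    Module.charIdeal (IwasawaAlgebra p) M = Ideal.span {charElement p μs fs}

/-- The characteristic ideal of any `Λ`-module is principal: `Λ` is a UFD, so its height-one
primes are principal, and `charIdeal` is a (finite, or empty) product of powers of them
(Washington §13.2). [cite: Washington1997, §13.2] -/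
def charIdeal_isPrincipal : Prop :=
  (Module.charIdeal (IwasawaAlgebra p) M).IsPrincipal

/-- `μ(M) = ∑ μᵢ` for `M ∼ E(μs, fs)` with distinguished `fⱼ` (Washington §13.2). [cite: Washington1997, §13.2] -/
def muInvariant_eq_sum : Prop :=
  ∀ [Module.Finite (IwasawaAlgebra p) M] {μs : List ℕ} {fs : List (ℤ_[p][X] × ℕ)} (hfs : ∀ f ∈ fs, f.1.IsDistinguishedAt (IsLocalRing.maximalIdeal ℤ_[p])) (h : Module.ArePseudoIsomorphic (IwasawaAlgebra p) M (elementaryModule p μs fs)),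
    muInvariant p M = μs.sum

/-- `λ(M) = ∑ nⱼ deg fⱼ` for `M ∼ E(μs, fs)` with distinguished `fⱼ`
(Washington §13.2, using Prop. 13.8: `Λ/(f) ≅ ℤₚ^{deg f}` for distinguished `f`). [cite: Washington1997, §13.2 and Prop. 13.8] -/
def lambdaInvariant_eq_sum_natDegree : Prop :=
  ∀ [Module.Finite (IwasawaAlgebra p) M] {μs : List ℕ} {fs : List (ℤ_[p][X] × ℕ)} (hfs : ∀ f ∈ fs, f.1.IsDistinguishedAt (IsLocalRing.maximalIdeal ℤ_[p])) (h : Module.ArePseudoIsomorphic (IwasawaAlgebra p) M (elementaryModule p μs fs)),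
    lambdaInvariant p M = (fs.map fun f => f.2 * f.1.natDegree).sum

/-- For a finitely generated torsion `Λ`-module, `μ(M) = 0` iff `M` is finitely generated as a
`ℤₚ`-module (Washington §13.2, cf. Prop. 13.23 and the discussion after Thm 13.12). [cite: Washington1997, §13.2] -/
def muInvariant_eq_zero_iff : Prop :=
  ∀ [Module.Finite (IwasawaAlgebra p) M] (hM : Module.IsTorsion (IwasawaAlgebra p) M),
    muInvariant p M = 0 ↔
      Module.Finite ℤ_[p] (RestrictScalars ℤ_[p] (IwasawaAlgebra p) M)

/-- The characteristic ideal is multiplicative in short exact sequences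
`0 → M' → M → M'' → 0` of finitely generated torsion `Λ`-modules
(Bourbaki AC VII §4.5 Prop. 10; Washington §13.2 (additivity of `μ`, `λ`); NSW Ch. V §3). [cite: NeukirchSchmidtWingberg2008, Ch. V §3 (multiplicativity of characteristic ideals); Bourbaki AC VII §4.5 Prop. 10] -/
def charIdeal_mul_of_shortExact : Prop :=
  ∀ [Module.Finite (IwasawaAlgebra p) M] (hM : Module.IsTorsion (IwasawaAlgebra p) M) {M' M'' : Type*} [AddCommGroup M'] [Module (IwasawaAlgebra p) M'] [AddCommGroup M''] [Module (IwasawaAlgebra p) M''] (f : M' →ₗ[IwasawaAlgebra p] M) (g : M →ₗ[IwasawaAlgebra p] M'') (hf : Function.Injective f) (hg : Function.Surjective g) (hfg : Function.Exact f g),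
    Module.charIdeal (IwasawaAlgebra p) M =
      Module.charIdeal (IwasawaAlgebra p) M' * Module.charIdeal (IwasawaAlgebra p) M''

/-- `μ` is additive in short exact sequences of finitely generated torsion `Λ`-modules
(Washington §13.2). [cite: Washington1997, §13.2] -/
def muInvariant_add_of_shortExact : Prop :=
  ∀ [Module.Finite (IwasawaAlgebra p) M] (hM : Module.IsTorsion (IwasawaAlgebra p) M) {M' M'' : Type*} [AddCommGroup M'] [Module (IwasawaAlgebra p) M'] [AddCommGroup M''] [Module (IwasawaAlgebra p) M''] (f : M' →ₗ[IwasawaAlgebra p] M) (g : M →ₗ[IwasawaAlgebra p] M'') (hf : Function.Injective f) (hg : Function.Surjective g) (hfg : Function.Exact f g),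
    muInvariant p M = muInvariant p M' + muInvariant p M''

end Invariants

/-! ## Discharge of `lambdaInvariant_eq_sum_natDegree` (appended; Mathlib-only proofs)

Architecture (Washington §13.2; Lang, *Cyclotomic Fields I–II*, Ch. 5 §§2–3):
`dim Λ = 2` ⟹ primes not containing `p` have height `≤ 1` ⟹ pseudo-null modules are `p`-power
torsion elementwise ⟹ (flat base change to `ℚₚ`, `p` invertible) `ℚₚ ⊗ M ≅ ℚₚ ⊗ ⨁ⱼ Λ/(fⱼ^{nⱼ})`
⟹ `λ(M) = ∑ⱼ rank_{ℤₚ} Λ/(fⱼ^{nⱼ}) = ∑ⱼ nⱼ deg fⱼ` by Weierstrass division. -/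

namespace IwasawaAlgebra

variable (p : ℕ) [Fact p.Prime]

/-- `Λ ⧸ (T) ≃+* ℤ_[p]` via the constant coefficient. [folklore] -/
def quotientSpanXEquiv :
    (IwasawaAlgebra p ⧸ Ideal.span {(PowerSeries.X : IwasawaAlgebra p)}) ≃+* ℤ_[p] :=
  (Ideal.quotEquivOfEq (by
    ext f
    rw [RingHom.mem_ker, Ideal.mem_span_singleton, PowerSeries.X_dvd_iff])).trans
    (RingHom.quotientKerEquivOfSurjective (PowerSeries.constantCoeff_surj (R := ℤ_[p])))

/-- `Λ = ℤ_[p]⟦T⟧` has Krull dimension `2` (`dim Λ/(T) + 1 = dim ℤ_[p] + 1`; Washington §13.2: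
the primes of `Λ` are `0`, `(p)`, `(f)` for `f` irreducible distinguished, and `(p, T)`). [folklore] -/
theorem ringKrullDim_eq_two : ringKrullDim (IwasawaAlgebra p) = 2 := by
  have hX : (PowerSeries.X : IwasawaAlgebra p) ∈ IsLocalRing.maximalIdeal (IwasawaAlgebra p) := by
    rw [IsLocalRing.mem_maximalIdeal, mem_nonunits_iff, PowerSeries.isUnit_iff_constantCoeff]
    simp
  have h := ringKrullDim_quotient_span_singleton_succ_eq_ringKrullDim_of_mem_nonZeroDivisors
    (mem_nonZeroDivisors_of_ne_zero (PowerSeries.X_ne_zero (R := ℤ_[p]))) hX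
  rw [ringKrullDim_eq_of_ringEquiv (quotientSpanXEquiv p),
    IsPrincipalIdealRing.ringKrullDim_eq_one _ (IsDiscreteValuationRing.not_isField ℤ_[p])] at h
  rw [← h]
  rfl

/-- `p ∈ 𝔪_Λ = (p, T)`. [folklore] -/
theorem C_p_mem_maximalIdeal :
    (PowerSeries.C (p : ℤ_[p]) : IwasawaAlgebra p) ∈ IsLocalRing.maximalIdeal (IwasawaAlgebra p) := by
  rw [IsLocalRing.mem_maximalIdeal, mem_nonunits_iff, PowerSeries.isUnit_iff_constantCoeff]
  simpa using PadicInt.p_nonunit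

/-- A prime of `Λ` not containing `p` has height `≤ 1` (it is strictly below `𝔪 = (p, T)`, which has
height `dim Λ = 2`). [folklore] -/
theorem height_le_one_of_C_p_notMem (𝔮 : Ideal (IwasawaAlgebra p)) [𝔮.IsPrime]
    (hp : (PowerSeries.C (p : ℤ_[p]) : IwasawaAlgebra p) ∉ 𝔮) : 𝔮.height ≤ 1 := by
  have hlt : 𝔮 < IsLocalRing.maximalIdeal (IwasawaAlgebra p) :=
    lt_of_le_of_ne (IsLocalRing.le_maximalIdeal Ideal.IsPrime.ne_top')
      (fun h => hp (h ▸ C_p_mem_maximalIdeal p))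
  have h1 := Ideal.height_add_one_le_of_lt_of_isPrime hlt
  have h2 : ((IsLocalRing.maximalIdeal (IwasawaAlgebra p)).height : WithBot ℕ∞) ≤ 2 :=
    ringKrullDim_eq_two p ▸ Ideal.height_le_ringKrullDim_of_isPrime
  have h3 : (IsLocalRing.maximalIdeal (IwasawaAlgebra p)).height ≤ 2 := by
    rw [show (2 : WithBot ℕ∞) = ((2 : ℕ∞) : WithBot ℕ∞) from rfl] at h2
    exact WithBot.coe_le_coe.1 h2
  have h4 : 𝔮.height + 1 ≤ 1 + 1 := h1.trans h3
  exact (WithTop.add_le_add_iff_right WithTop.one_ne_top).1 h4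

end IwasawaAlgebra

section PseudoNull

open IwasawaAlgebra

variable (p : ℕ) [Fact p.Prime]

/-- Every element of a pseudo-null `Λ`-module is killed by a power of `p`: the annihilator of the
element lies in no prime of height `≤ 1`, hence in no prime avoiding `p`, so `p` is in its radical.
(For finitely generated modules this is "pseudo-null = finite", Washington §13.2.) [folklore] -/
theorem exists_C_p_pow_smul_eq_zero_of_isPseudoNull {K : Type*} [AddCommGroup K]
    [Module (IwasawaAlgebra p) K] (hK : Module.IsPseudoNull (IwasawaAlgebra p) K) (z : K) :
    ∃ n : ℕ, (PowerSeries.C (p : ℤ_[p]) : IwasawaAlgebra p) ^ n • z = 0 := by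
  by_contra! H
  set J : Ideal (IwasawaAlgebra p) := Ideal.torsionOf (IwasawaAlgebra p) K z
  have hrad : (PowerSeries.C (p : ℤ_[p]) : IwasawaAlgebra p) ∉ J.radical := by
    rintro ⟨n, hn⟩
    exact H n ((Ideal.mem_torsionOf_iff z _).1 hn)
  rw [Ideal.radical_eq_sInf, Submodule.mem_sInf] at hrad
  push Not at hrad
  obtain ⟨𝔮, ⟨hJ𝔮, h𝔮⟩, hp𝔮⟩ := hrad
  have hht := height_le_one_of_C_p_notMem p 𝔮 hp𝔮
  haveI := h𝔮
  have hsub : Subsingleton (LocalizedModule (Ideal.primeCompl 𝔮) K) := hK ⟨𝔮, h𝔮⟩ hht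
  have hz : (LocalizedModule.mk z 1 : LocalizedModule (Ideal.primeCompl 𝔮) K) =
      LocalizedModule.mk 0 1 :=
    Subsingleton.elim _ _
  rw [LocalizedModule.mk_eq] at hz
  obtain ⟨u, hu⟩ := hz
  simp only [one_smul, smul_zero] at hu
  have hu' : (u : IwasawaAlgebra p) ∈ J := (Ideal.mem_torsionOf_iff z _).2 hu
  exact u.2 (hJ𝔮 hu')

end PseudoNull

namespace Module

/-! Generic: base change to a flat algebra in which `a` becomes a unit kills `a`-power torsion.
Intended Mathlib home: next to `Module.Flat.lTensor_exact` / `IsLocalizedModule`. -/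

section BaseChangeTorsion

variable {A : Type*} [CommRing A] (F : Type*) [CommRing F] [Algebra A F] {a : A}

/-- If `aⁿ x = 0` and `a` is a unit in the `A`-algebra `F`, then `c ⊗ x = 0` in `F ⊗[A] X`.
[folklore] -/
theorem tmul_eq_zero_of_pow_smul_eq_zero (ha : IsUnit (algebraMap A F a)) {X : Type*}
    [AddCommGroup X] [_root_.Module A X] {x : X} {n : ℕ} (hx : a ^ n • x = 0) (c : F) :
    c ⊗ₜ[A] x = 0 := by
  obtain ⟨u, hu⟩ := ha
  have hc : c = a ^ n • (c * ↑(u ^ n)⁻¹) := by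
    rw [Algebra.smul_def, map_pow, ← hu, ← Units.val_pow_eq_pow_val, mul_left_comm,
      Units.mul_inv, mul_one]
  rw [hc, TensorProduct.smul_tmul, hx, TensorProduct.tmul_zero]

variable [_root_.Module.Flat A F]

/-- If `f : M → N` is `A`-linear with `a`-power-torsion kernel and cokernel, and `F` is a flat
`A`-algebra in which `a` is invertible, then `F ⊗ f` is bijective. [folklore] -/
theorem bijective_baseChange_of_pow_smul (ha : IsUnit (algebraMap A F a))
    {M N : Type*} [AddCommGroup M] [_root_.Module A M] [AddCommGroup N] [_root_.Module A N]
    (f : M →ₗ[A] N) (hker : ∀ x, f x = 0 → ∃ n : ℕ, a ^ n • x = 0)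
    (hcoker : ∀ y, ∃ (n : ℕ) (x : M), a ^ n • y = f x) :
    Function.Bijective (f.baseChange F) := by
  constructor
  · -- injectivity: factor `f` through `M ⧸ ker f`
    rw [LinearMap.baseChange_eq_ltensor]
    set K := LinearMap.ker f
    have hfac : (K.liftQ f le_rfl) ∘ₗ K.mkQ = f := K.liftQ_mkQ f _
    have hι : Function.Injective (K.liftQ f le_rfl) :=
      LinearMap.ker_eq_bot.1 (K.ker_liftQ_eq_bot f _ le_rfl)
    rw [← hfac, LinearMap.lTensor_comp, LinearMap.coe_comp]
    refine (Module.Flat.lTensor_preserves_injective_linearMap _ hι).comp ?_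
    have hex := Module.Flat.lTensor_exact F (LinearMap.exact_subtype_mkQ K)
    rw [← LinearMap.ker_eq_bot, LinearMap.exact_iff.1 hex, LinearMap.range_eq_bot]
    refine TensorProduct.ext' fun c k => ?_
    obtain ⟨n, hn⟩ := hker k k.2
    simp only [LinearMap.lTensor_tmul, Submodule.subtype_apply, LinearMap.zero_apply]
    exact tmul_eq_zero_of_pow_smul_eq_zero F ha hn c
  · intro z
    induction z using TensorProduct.induction_on with
    | zero => exact ⟨0, map_zero _⟩
    | tmul c y =>
      obtain ⟨n, x, hx⟩ := hcoker y
      obtain ⟨u, hu⟩ := ha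
      refine ⟨(c * ↑(u ^ n)⁻¹) ⊗ₜ x, ?_⟩
      rw [LinearMap.baseChange_tmul, ← hx, ← TensorProduct.smul_tmul, Algebra.smul_def, map_pow,
        ← hu, ← Units.val_pow_eq_pow_val, mul_left_comm, Units.mul_inv, mul_one]
    | add x y hx hy =>
      obtain ⟨x', hx'⟩ := hx
      obtain ⟨y', hy'⟩ := hy
      exact ⟨x' + y', by rw [map_add, hx', hy']⟩

/-- Under the hypotheses of `bijective_baseChange_of_pow_smul`, `F ⊗ M` and `F ⊗ N` have the same
`F`-dimension. [folklore] -/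
theorem finrank_baseChange_eq_of_pow_smul (ha : IsUnit (algebraMap A F a))
    {M N : Type*} [AddCommGroup M] [_root_.Module A M] [AddCommGroup N] [_root_.Module A N]
    (f : M →ₗ[A] N) (hker : ∀ x, f x = 0 → ∃ n : ℕ, a ^ n • x = 0)
    (hcoker : ∀ y, ∃ (n : ℕ) (x : M), a ^ n • y = f x) :
    Module.finrank F (F ⊗[A] M) = Module.finrank F (F ⊗[A] N) :=
  (LinearEquiv.ofBijective _ (bijective_baseChange_of_pow_smul F ha f hker hcoker)).finrank_eq

end BaseChangeTorsion

end Module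


/-! ### The `λ`-invariant of an elementary module -/

section LambdaProof

open IwasawaAlgebra

variable (p : ℕ) [Fact p.Prime]

/-- Powers of a distinguished polynomial are distinguished (cf. `Polynomial.IsDistinguishedAt.mul`).
[folklore] -/
theorem isDistinguishedAt_pow {R : Type*} [CommRing R] {f : R[X]} {I : Ideal R}
    (hf : f.IsDistinguishedAt I) : ∀ n : ℕ, (f ^ n).IsDistinguishedAt I
  | 0 => by
    rw [pow_zero]
    exact ⟨⟨fun {i} hi => absurd hi (by simp)⟩, Polynomial.monic_one⟩
  | n + 1 => by
    rw [pow_succ]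
    exact (isDistinguishedAt_pow hf n).mul hf

/-- `ℤ_[p][X] ⧸ (f ^ n) ≃ₗ[ℤ_[p]] Λ ⧸ (f ^ n)` for a distinguished polynomial `f`
(Weierstrass division; Washington Prop. 13.8 / Lang, *Cyclotomic Fields*, Ch. 5 Thm. 2.1, via
Mathlib's `Polynomial.IsDistinguishedAt.algEquivQuotient`).
[cite: Lang1980, Ch. 5 §2 Thm. 2.1 (Euclidean algorithm); Washington1997, Prop. 13.8] -/
def quotientPowEquiv {f : ℤ_[p][X]} (hf : f.IsDistinguishedAt (IsLocalRing.maximalIdeal ℤ_[p]))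
    (n : ℕ) :
    (ℤ_[p][X] ⧸ Ideal.span {f ^ n}) ≃ₗ[ℤ_[p]]
      (IwasawaAlgebra p ⧸ Ideal.span {(f : IwasawaAlgebra p) ^ n}) :=
  ((isDistinguishedAt_pow hf n).algEquivQuotient.trans
    (Ideal.quotientEquivAlgOfEq ℤ_[p] (by rw [Polynomial.coe_pow]))).toLinearEquiv

/-- `Λ/(fⁿ)` is a free `ℤₚ`-module for distinguished `f`.
[cite: Lang1980, Ch. 5 §2 Thm. 2.1; Washington1997, Prop. 13.8] -/
theorem free_quotient_pow {f : ℤ_[p][X]}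
    (hf : f.IsDistinguishedAt (IsLocalRing.maximalIdeal ℤ_[p])) (n : ℕ) :
    Module.Free ℤ_[p] (IwasawaAlgebra p ⧸ Ideal.span {(f : IwasawaAlgebra p) ^ n}) :=
  haveI := (isDistinguishedAt_pow hf n).monic.free_quotient
  Module.Free.of_equiv (quotientPowEquiv p hf n)

/-- `Λ/(fⁿ)` is a finitely generated `ℤₚ`-module for distinguished `f`.
[cite: Lang1980, Ch. 5 §2 Thm. 2.1; Washington1997, Prop. 13.8] -/
theorem finite_quotient_pow {f : ℤ_[p][X]}
    (hf : f.IsDistinguishedAt (IsLocalRing.maximalIdeal ℤ_[p])) (n : ℕ) :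
    Module.Finite ℤ_[p] (IwasawaAlgebra p ⧸ Ideal.span {(f : IwasawaAlgebra p) ^ n}) :=
  haveI := (isDistinguishedAt_pow hf n).monic.finite_quotient
  Module.Finite.equiv (quotientPowEquiv p hf n)

/-- `rank_{ℤₚ} Λ/(fⁿ) = n · deg f` for distinguished `f` (basis `1, T, …, T^{n deg f - 1}` by the
Euclidean algorithm). [cite: Lang1980, Ch. 5 §2 Thm. 2.1; Washington1997, Prop. 13.8] -/
theorem finrank_quotient_pow {f : ℤ_[p][X]}
    (hf : f.IsDistinguishedAt (IsLocalRing.maximalIdeal ℤ_[p])) (n : ℕ) :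
    Module.finrank ℤ_[p] (IwasawaAlgebra p ⧸ Ideal.span {(f : IwasawaAlgebra p) ^ n}) =
      n * f.natDegree := by
  rw [← (quotientPowEquiv p hf n).finrank_eq,
    finrank_quotient_span_eq_natDegree' (isDistinguishedAt_pow hf n).monic, hf.monic.natDegree_pow]

/-- The `p`-primary part `⨁ Λ/(p^{μᵢ})` of an elementary module is killed by `p ^ (∑ μᵢ)`.
[folklore] -/
theorem C_p_pow_sum_smul_eq_zero (μs : List ℕ)
    (y : ⨁ i : Fin μs.length,
      IwasawaAlgebra p ⧸ Ideal.span {PowerSeries.C ((p : ℤ_[p]) ^ μs.get i)}) :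
    (PowerSeries.C (p : ℤ_[p]) : IwasawaAlgebra p) ^ μs.sum • y = 0 := by
  induction y using DirectSum.induction_on with
  | zero => exact smul_zero _
  | of i y =>
    obtain ⟨y, rfl⟩ := Ideal.Quotient.mk_surjective y
    rw [← DirectSum.of_smul,
      show (PowerSeries.C (p : ℤ_[p]) : IwasawaAlgebra p) ^ μs.sum • Ideal.Quotient.mk _ y =
        Ideal.Quotient.mk _ ((PowerSeries.C (p : ℤ_[p]) : IwasawaAlgebra p) ^ μs.sum * y) from rfl,
      Ideal.Quotient.eq_zero_iff_mem.2, map_zero]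
    refine Ideal.mul_mem_right _ _ (Ideal.mem_span_singleton.2 ?_)
    rw [← map_pow]
    exact map_dvd _ (pow_dvd_pow _ (List.le_sum_of_mem (List.get_mem μs i)))
  | add x y hx hy => rw [smul_add, hx, hy, add_zero]

/-- `p` is a unit in `ℚ_[p]`. [folklore] -/
theorem isUnit_algebraMap_p : IsUnit (algebraMap ℤ_[p] ℚ_[p] (p : ℤ_[p])) := by
  rw [map_natCast, isUnit_iff_ne_zero]
  exact_mod_cast (Fact.out : p.Prime).ne_zero

/-- The `ℤₚ`-action of `pⁿ` on a `Λ`-module is the `Λ`-action of `C p ^ n`. [folklore] -/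
theorem algebraMap_p_pow_smul {N : Type*} [AddCommGroup N] [Module (IwasawaAlgebra p) N]
    [Module ℤ_[p] N] [IsScalarTower ℤ_[p] (IwasawaAlgebra p) N] (n : ℕ) (y : N) :
    (p : ℤ_[p]) ^ n • y = (PowerSeries.C (p : ℤ_[p]) : IwasawaAlgebra p) ^ n • y := by
  rw [← algebraMap_smul (IwasawaAlgebra p), map_pow, ← PowerSeries.C_eq_algebraMap]

/-- **Discharge** of `lambdaInvariant_eq_sum_natDegree`: `λ(M) = ∑ nⱼ deg fⱼ` for `M ∼ E(μs, fs)`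
with distinguished `fⱼ`. Proof: `dim Λ = 2`, so a pseudo-null `Λ`-module is `p`-power torsion
elementwise; `ℚₚ` is flat over `ℤₚ`, so `ℚₚ ⊗ M ≅ ℚₚ ⊗ E ≅ ℚₚ ⊗ ⨁ Λ/(fⱼ^{nⱼ})`, and
`Λ/(fⱼ^{nⱼ}) ≅ ℤₚ^{nⱼ deg fⱼ}` by Weierstrass division.
[cite: Washington1997, §13.2 (definition of λ following Thm. 13.12) and Prop. 13.8;
Lang1980, Ch. 5 §2 Thm. 2.1 and §3 Thm. 3.1] -/
theorem lambdaInvariant_eq_sum_natDegree_holds (M : Type*) [AddCommGroup M]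
    [Module (IwasawaAlgebra p) M] : lambdaInvariant_eq_sum_natDegree p M := by
  intro _ μs fs hfs hφ
  obtain ⟨φ, hkerφ, hcokerφ⟩ := hφ
  -- the two halves of the elementary module
  let E₁ := ⨁ i : Fin μs.length,
    IwasawaAlgebra p ⧸ Ideal.span {PowerSeries.C ((p : ℤ_[p]) ^ μs.get i)}
  let E₂ := ⨁ j : Fin fs.length,
    IwasawaAlgebra p ⧸ Ideal.span {((fs.get j).1 : IwasawaAlgebra p) ^ (fs.get j).2}
  haveI : ∀ j : Fin fs.length, Module.Free ℤ_[p]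
      (IwasawaAlgebra p ⧸ Ideal.span {((fs.get j).1 : IwasawaAlgebra p) ^ (fs.get j).2}) :=
    fun j => free_quotient_pow p (hfs _ (List.get_mem fs j)) _
  haveI : ∀ j : Fin fs.length, Module.Finite ℤ_[p]
      (IwasawaAlgebra p ⧸ Ideal.span {((fs.get j).1 : IwasawaAlgebra p) ^ (fs.get j).2}) :=
    fun j => finite_quotient_pow p (hfs _ (List.get_mem fs j)) _
  haveI : Module.Flat ℤ_[p] ℚ_[p] := IsLocalization.flat ℚ_[p] (nonZeroDivisors ℤ_[p])
  -- `M` with its `ℤₚ`-structure (definitionally that of `RestrictScalars ℤₚ Λ M`)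
  letI : Module ℤ_[p] M := Module.compHom M (algebraMap ℤ_[p] (IwasawaAlgebra p))
  haveI : IsScalarTower ℤ_[p] (IwasawaAlgebra p) M := IsScalarTower.of_compHom _ _ _
  -- the composite `M → E → E₂`
  let φ' : M →ₗ[IwasawaAlgebra p] E₁ × E₂ := φ
  let ψ : M →ₗ[IwasawaAlgebra p] E₂ := LinearMap.snd (IwasawaAlgebra p) E₁ E₂ ∘ₗ φ'
  have hker : ∀ x : M, ψ.restrictScalars ℤ_[p] x = 0 → ∃ n : ℕ, (p : ℤ_[p]) ^ n • x = 0 := by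
    intro x hx
    have hx2 : (φ' x).2 = 0 := hx
    have hN : (PowerSeries.C (p : ℤ_[p]) : IwasawaAlgebra p) ^ μs.sum • x ∈ LinearMap.ker φ' := by
      rw [LinearMap.mem_ker, map_smul]
      ext1
      · rw [Prod.smul_fst, C_p_pow_sum_smul_eq_zero, Prod.fst_zero]
      · rw [Prod.smul_snd, hx2, smul_zero, Prod.snd_zero]
    obtain ⟨n, hn⟩ := exists_C_p_pow_smul_eq_zero_of_isPseudoNull p hkerφ ⟨_, hN⟩
    refine ⟨n + μs.sum, ?_⟩
    have hn' := congrArg Subtype.val hn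
    simp only [SetLike.val_smul, ZeroMemClass.coe_zero] at hn'
    rw [algebraMap_p_pow_smul p (n + μs.sum) x, pow_add, mul_smul]
    exact hn'
  have hcoker : ∀ y : E₂, ∃ (n : ℕ) (x : M),
      (p : ℤ_[p]) ^ n • y = ψ.restrictScalars ℤ_[p] x := by
    intro y
    obtain ⟨n, hn⟩ := exists_C_p_pow_smul_eq_zero_of_isPseudoNull p hcokerφ
      (Submodule.Quotient.mk (show elementaryModule p μs fs from ((0 : E₁), y)))
    rw [← Submodule.Quotient.mk_smul, Submodule.Quotient.mk_eq_zero, LinearMap.mem_range] at hn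
    obtain ⟨x, hx⟩ := hn
    refine ⟨n, x, ?_⟩
    have hx' : φ' x = (PowerSeries.C (p : ℤ_[p]) : IwasawaAlgebra p) ^ n • ((0 : E₁), y) := hx
    rw [LinearMap.restrictScalars_apply, LinearMap.comp_apply, hx', LinearMap.snd_apply,
      Prod.smul_snd]
    exact algebraMap_p_pow_smul p n y
  have key := Module.finrank_baseChange_eq_of_pow_smul ℚ_[p] (isUnit_algebraMap_p p)
    (M := M) (N := E₂) (ψ.restrictScalars ℤ_[p]) hker hcoker
  change Module.finrank ℚ_[p] (ℚ_[p] ⊗[ℤ_[p]] M) = _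
  refine key.trans ?_
  haveI : Module.Free ℤ_[p] E₂ := inferInstanceAs (Module.Free ℤ_[p] (⨁ j : Fin fs.length,
    IwasawaAlgebra p ⧸ Ideal.span {((fs.get j).1 : IwasawaAlgebra p) ^ (fs.get j).2}))
  rw [Module.finrank_baseChange]
  change Module.finrank ℤ_[p] (⨁ j : Fin fs.length,
    IwasawaAlgebra p ⧸ Ideal.span {((fs.get j).1 : IwasawaAlgebra p) ^ (fs.get j).2}) = _
  rw [Module.finrank_directSum,
    Finset.sum_congr rfl fun j _ => finrank_quotient_pow p (hfs _ (List.get_mem fs j)) _]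
  simp only [List.get_eq_getElem]
  exact Fin.sum_univ_fun_getElem fs (fun f => f.2 * f.1.natDegree)

end LambdaProof

/-! ### Discharge of `charIdeal_isPrincipal` (appended; Mathlib-only proof)

Architecture (Washington §13.2, discussion after Thm 13.12): `Λ = ℤ_[p]⟦T⟧` is a UFD (Weierstrass
preparation; in Mathlib, `PowerSeries` over a PID is a `UniqueFactorizationMonoid`, and the instance
fires through the `IwasawaAlgebra` abbreviation), so every height-one prime `𝔭` of `Λ` is principal;
hence so is each `𝔭 ^ n` and their product `charIdeal Λ M` (a `finprod`, equal to `1 = ⊤` in the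
junk case of infinite support, which is again principal). -/

section CharIdealPrincipal

variable (p : ℕ) [Fact p.Prime] (M : Type*) [AddCommGroup M] [Module (IwasawaAlgebra p) M]

/-- **Discharge of `charIdeal_isPrincipal`.** The characteristic ideal of any `Λ`-module is
principal: `Λ = ℤ_[p]⟦T⟧` is a UFD, so each height-one prime `𝔭` is principal
(`UniqueFactorizationMonoid.isPrincipal_of_height_eq_one`), hence so is each `𝔭 ^ n` and their
(finite, or junk-value `1 = ⊤`) product `charIdeal Λ M`
(Washington, *Introduction to Cyclotomic Fields*, §13.2, discussion after Thm 13.12).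
[cite: Washington1997, §13.2] -/
theorem charIdeal_isPrincipal_holds : charIdeal_isPrincipal p M := by
  unfold charIdeal_isPrincipal Module.charIdeal
  rw [← Ideal.mem_isPrincipalSubmonoid_iff]
  refine finprod_mem_induction (· ∈ Ideal.isPrincipalSubmonoid (IwasawaAlgebra p))
    (Submonoid.one_mem _) (fun _ _ hx hy => Submonoid.mul_mem _ hx hy) ?_
  intro 𝔭 h𝔭
  refine Submonoid.pow_mem _ ?_ _
  obtain ⟨g, hg⟩ := UniqueFactorizationMonoid.isPrincipal_of_height_eq_one h𝔭
  rw [hg]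
  exact Ideal.span_singleton_mem_isPrincipalSubmonoid g

end CharIdealPrincipal

end Literature.NumberTheory.EllipticCurves
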